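import Summits.Ventures.CertifiedManyBodySolver.Downfold.EmeryBoxesHg1201JetWindowP0T
import Summits.Ventures.CertifiedManyBodySolver.Downfold.EmeryFermiFillingLa214
import HarnessLib

/-!
# THE WHOLE-BAND (OBJECT-M) ONE-BAND SET AS CERTIFIED WINDOWS — HgBa₂CuO₄ at P = 0, n_H = 1.125 (ν = 7/16) — ASSEMBLED: `(t_J, t′_J/t_J, t″_J/t_J)` of the nodal 2-jet at ε_F
# for EVERY member of box #19's σ companion `emeryBoxHg1201v114` (INFL-3to1-B §B.101)

Venture CertifiedManyBodySolver, cell `pub/hubbard-downfold` (stage S1; INFLATION-RULES-3to1-B §B.101), seat hubbard-downfold-mod-4 (technique B = band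
level, g45); namespace `Summit.Ventures.CertifiedManyBodySolver.Downfold.Emery`. Everything PROVED (`decide +kernel` on the bisection certificates of
`EmeryBandJetWindow.jetLeaf` — slope arithmetic `EmerySlopeArith(Sound)` — composed with the sub-box ε_F brackets of `EmeryFermiFillingHg1201Subs` and
`abFilling_fermiEnergyOf'`; generator HOME/hubbard-downfold-mod-4/jet-g45/gen/emit_boxes2.py, bit-exact python mirror of the kernel checker).
WHAT THIS IS NOT: a statement about HgBa₂CuO₄ at P = 0 — the typed box (box #19's σ companion `emeryBoxHg1201v114` (HgBa₂CuO₄ at P = 0; Δ_pd [1.4, 2.5] × t_pd [1.12, 1.32] × t_pp [0.64, 0.85] × t_pp′ [0.111, 0.208] eV)) is SCREENING-GRADE; `U = 0` one-body kinematics of the σ model; the ε_F coupling is per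
SUB-BOX (each member's jet is bounded over its sub-box's certified ε_F bracket, not at its own ε_F), so the windows are OUTER bounds of the true ranges.

| Δ_pd range | window |
|---|---|
| whole Δ_pd hull [1.4, 2.5] | t_J [0.2956, 0.5438] eV, t′_J/t_J [-0.2452, -0.0436], t″_J/t_J [0.0549, 0.3504] |
| DFT-level Δ_pd tag [1.4, 1.93] | t_J [0.3003, 0.5438] eV, t′_J/t_J [-0.2452, -0.0436], t″_J/t_J [0.0638, 0.3504] |
| solver-level Δ_pd tag [2.17, 2.5] | t_J [0.2956, 0.5247] eV, t′_J/t_J [-0.2279, -0.0441], t″_J/t_J [0.0549, 0.2700] |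

Sources: [HybertsenSchluterChristensen1989, Eq. (1)]; [AndersenEtAl1995, §6]; [PavariniEtAl2001, Eq. (1)]; interval/slope arithmetic [folklore].
-/

noncomputable section

namespace Summit.Ventures.CertifiedManyBodySolver.Downfold.Emery

open Real Set Literature.Analysis.ValidatedNumerics.Numerics

/-- **HgBa₂CuO₄ at P = 0, whole Δ_pd hull [1.4, 2.5], n_H = 1.125 (ν = 7/16)** — for EVERY member θ = (Δ, t_pd, t_pp, t_pp′), with ε = ε_F(θ) and x₀ = xNode(ε_F): nodal-jet hopping
`t_J ∈ [0.2956, 0.5438]` eV, `t′_J/t_J ∈ [-0.2452, -0.0436]`, `t″_J/t_J ∈ [0.0549, 0.3504]` (union of the sub-box windows 0_0, 0_1, 1_0, 1_1, 2_0, 2_1, 3_0, 3_1). [folklore] -/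
theorem hg1201Box_jetWindow_nH1125 {Δ a b c : ℝ} (hΔ : Δ ∈ Icc (7 / 5 : ℝ) (5 / 2 : ℝ)) (ha : a ∈ Icc (28 / 25 : ℝ) (33 / 25 : ℝ))
    (hb : b ∈ Icc (16 / 25 : ℝ) (17 / 20 : ℝ)) (hc : c ∈ Icc (111 / 1000 : ℝ) (26 / 125 : ℝ)) :
    jetT Δ a b c (xNode Δ a b c (fermiEnergyOf Δ a b c (7 / 16 : ℝ))) (fermiEnergyOf Δ a b c (7 / 16 : ℝ)) ∈ Icc (739 / 2500 : ℝ) (2719 / 5000 : ℝ) ∧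
      jetTp Δ a b c (xNode Δ a b c (fermiEnergyOf Δ a b c (7 / 16 : ℝ))) (fermiEnergyOf Δ a b c (7 / 16 : ℝ)) / jetT Δ a b c (xNode Δ a b c (fermiEnergyOf Δ a b c (7 / 16 : ℝ))) (fermiEnergyOf Δ a b c (7 / 16 : ℝ)) ∈ Icc (-613 / 2500 : ℝ) (-109 / 2500 : ℝ) ∧
      jetTpp Δ a b c (xNode Δ a b c (fermiEnergyOf Δ a b c (7 / 16 : ℝ))) (fermiEnergyOf Δ a b c (7 / 16 : ℝ)) / jetT Δ a b c (xNode Δ a b c (fermiEnergyOf Δ a b c (7 / 16 : ℝ))) (fermiEnergyOf Δ a b c (7 / 16 : ℝ)) ∈ Icc (549 / 10000 : ℝ) (219 / 625 : ℝ) := by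
  rcases mem_Icc_split hΔ (39 / 20 : ℝ) with hΔ | hΔ
  · rcases mem_Icc_split hΔ (67 / 40 : ℝ) with hΔ | hΔ
    · rcases mem_Icc_split ha (61 / 50 : ℝ) with ha' | ha'
      · exact (hg1201P0Jet_0_0 hΔ ha' hb hc).widen (by norm_num [SC]) (by norm_num [SC]) (by norm_num [SC])
          (by norm_num [SC]) (by norm_num [SC]) (by norm_num [SC])
      · exact (hg1201P0Jet_0_1 hΔ ha' hb hc).widen (by norm_num [SC]) (by norm_num [SC]) (by norm_num [SC])
          (by norm_num [SC]) (by norm_num [SC]) (by norm_num [SC])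
    · rcases mem_Icc_split ha (61 / 50 : ℝ) with ha' | ha'
      · exact (hg1201P0Jet_1_0 hΔ ha' hb hc).widen (by norm_num [SC]) (by norm_num [SC]) (by norm_num [SC])
          (by norm_num [SC]) (by norm_num [SC]) (by norm_num [SC])
      · exact (hg1201P0Jet_1_1 hΔ ha' hb hc).widen (by norm_num [SC]) (by norm_num [SC]) (by norm_num [SC])
          (by norm_num [SC]) (by norm_num [SC]) (by norm_num [SC])
  · rcases mem_Icc_split hΔ (89 / 40 : ℝ) with hΔ | hΔ
    · rcases mem_Icc_split ha (61 / 50 : ℝ) with ha' | ha'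
      · exact (hg1201P0Jet_2_0 hΔ ha' hb hc).widen (by norm_num [SC]) (by norm_num [SC]) (by norm_num [SC])
          (by norm_num [SC]) (by norm_num [SC]) (by norm_num [SC])
      · exact (hg1201P0Jet_2_1 hΔ ha' hb hc).widen (by norm_num [SC]) (by norm_num [SC]) (by norm_num [SC])
          (by norm_num [SC]) (by norm_num [SC]) (by norm_num [SC])
    · rcases mem_Icc_split ha (61 / 50 : ℝ) with ha' | ha'
      · exact (hg1201P0Jet_3_0 hΔ ha' hb hc).widen (by norm_num [SC]) (by norm_num [SC]) (by norm_num [SC])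
          (by norm_num [SC]) (by norm_num [SC]) (by norm_num [SC])
      · exact (hg1201P0Jet_3_1 hΔ ha' hb hc).widen (by norm_num [SC]) (by norm_num [SC]) (by norm_num [SC])
          (by norm_num [SC]) (by norm_num [SC]) (by norm_num [SC])

/-- **HgBa₂CuO₄ at P = 0, DFT-level Δ_pd tag [1.4, 1.93], n_H = 1.125 (ν = 7/16)** — for EVERY member θ = (Δ, t_pd, t_pp, t_pp′), with ε = ε_F(θ) and x₀ = xNode(ε_F): nodal-jet hopping
`t_J ∈ [0.3003, 0.5438]` eV, `t′_J/t_J ∈ [-0.2452, -0.0436]`, `t″_J/t_J ∈ [0.0638, 0.3504]` (union of the sub-box windows 0_0, 0_1, 1_0, 1_1). [folklore] -/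
theorem hg1201DFTBox_jetWindow_nH1125 {Δ a b c : ℝ} (hΔ : Δ ∈ Icc (7 / 5 : ℝ) (193 / 100 : ℝ)) (ha : a ∈ Icc (28 / 25 : ℝ) (33 / 25 : ℝ))
    (hb : b ∈ Icc (16 / 25 : ℝ) (17 / 20 : ℝ)) (hc : c ∈ Icc (111 / 1000 : ℝ) (26 / 125 : ℝ)) :
    jetT Δ a b c (xNode Δ a b c (fermiEnergyOf Δ a b c (7 / 16 : ℝ))) (fermiEnergyOf Δ a b c (7 / 16 : ℝ)) ∈ Icc (3003 / 10000 : ℝ) (2719 / 5000 : ℝ) ∧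
      jetTp Δ a b c (xNode Δ a b c (fermiEnergyOf Δ a b c (7 / 16 : ℝ))) (fermiEnergyOf Δ a b c (7 / 16 : ℝ)) / jetT Δ a b c (xNode Δ a b c (fermiEnergyOf Δ a b c (7 / 16 : ℝ))) (fermiEnergyOf Δ a b c (7 / 16 : ℝ)) ∈ Icc (-613 / 2500 : ℝ) (-109 / 2500 : ℝ) ∧
      jetTpp Δ a b c (xNode Δ a b c (fermiEnergyOf Δ a b c (7 / 16 : ℝ))) (fermiEnergyOf Δ a b c (7 / 16 : ℝ)) / jetT Δ a b c (xNode Δ a b c (fermiEnergyOf Δ a b c (7 / 16 : ℝ))) (fermiEnergyOf Δ a b c (7 / 16 : ℝ)) ∈ Icc (319 / 5000 : ℝ) (219 / 625 : ℝ) := by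
  rcases mem_Icc_split hΔ (67 / 40 : ℝ) with hΔ | hΔ
  · rcases mem_Icc_split ha (61 / 50 : ℝ) with ha' | ha'
    · exact (hg1201P0Jet_0_0 hΔ ha' hb hc).widen (by norm_num [SC]) (by norm_num [SC]) (by norm_num [SC])
        (by norm_num [SC]) (by norm_num [SC]) (by norm_num [SC])
    · exact (hg1201P0Jet_0_1 hΔ ha' hb hc).widen (by norm_num [SC]) (by norm_num [SC]) (by norm_num [SC])
        (by norm_num [SC]) (by norm_num [SC]) (by norm_num [SC])
  · rcases mem_Icc_split ha (61 / 50 : ℝ) with ha' | ha'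
    · exact (hg1201P0Jet_1_0 (⟨le_trans (by norm_num) hΔ.1, hΔ.2.trans (by norm_num)⟩) ha' hb hc).widen (by norm_num [SC]) (by norm_num [SC]) (by norm_num [SC])
        (by norm_num [SC]) (by norm_num [SC]) (by norm_num [SC])
    · exact (hg1201P0Jet_1_1 (⟨le_trans (by norm_num) hΔ.1, hΔ.2.trans (by norm_num)⟩) ha' hb hc).widen (by norm_num [SC]) (by norm_num [SC]) (by norm_num [SC])
        (by norm_num [SC]) (by norm_num [SC]) (by norm_num [SC])

/-- **HgBa₂CuO₄ at P = 0, solver-level Δ_pd tag [2.17, 2.5], n_H = 1.125 (ν = 7/16)** — for EVERY member θ = (Δ, t_pd, t_pp, t_pp′), with ε = ε_F(θ) and x₀ = xNode(ε_F): nodal-jet hopping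
`t_J ∈ [0.2956, 0.5247]` eV, `t′_J/t_J ∈ [-0.2279, -0.0441]`, `t″_J/t_J ∈ [0.0549, 0.2700]` (union of the sub-box windows 2_0, 2_1, 3_0, 3_1). [folklore] -/
theorem hg1201SOLBox_jetWindow_nH1125 {Δ a b c : ℝ} (hΔ : Δ ∈ Icc (217 / 100 : ℝ) (5 / 2 : ℝ)) (ha : a ∈ Icc (28 / 25 : ℝ) (33 / 25 : ℝ))
    (hb : b ∈ Icc (16 / 25 : ℝ) (17 / 20 : ℝ)) (hc : c ∈ Icc (111 / 1000 : ℝ) (26 / 125 : ℝ)) :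
    jetT Δ a b c (xNode Δ a b c (fermiEnergyOf Δ a b c (7 / 16 : ℝ))) (fermiEnergyOf Δ a b c (7 / 16 : ℝ)) ∈ Icc (739 / 2500 : ℝ) (5247 / 10000 : ℝ) ∧
      jetTp Δ a b c (xNode Δ a b c (fermiEnergyOf Δ a b c (7 / 16 : ℝ))) (fermiEnergyOf Δ a b c (7 / 16 : ℝ)) / jetT Δ a b c (xNode Δ a b c (fermiEnergyOf Δ a b c (7 / 16 : ℝ))) (fermiEnergyOf Δ a b c (7 / 16 : ℝ)) ∈ Icc (-2279 / 10000 : ℝ) (-441 / 10000 : ℝ) ∧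
      jetTpp Δ a b c (xNode Δ a b c (fermiEnergyOf Δ a b c (7 / 16 : ℝ))) (fermiEnergyOf Δ a b c (7 / 16 : ℝ)) / jetT Δ a b c (xNode Δ a b c (fermiEnergyOf Δ a b c (7 / 16 : ℝ))) (fermiEnergyOf Δ a b c (7 / 16 : ℝ)) ∈ Icc (549 / 10000 : ℝ) (27 / 100 : ℝ) := by
  rcases mem_Icc_split hΔ (89 / 40 : ℝ) with hΔ | hΔ
  · rcases mem_Icc_split ha (61 / 50 : ℝ) with ha' | ha'
    · exact (hg1201P0Jet_2_0 (⟨le_trans (by norm_num) hΔ.1, hΔ.2.trans (by norm_num)⟩) ha' hb hc).widen (by norm_num [SC]) (by norm_num [SC]) (by norm_num [SC])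
        (by norm_num [SC]) (by norm_num [SC]) (by norm_num [SC])
    · exact (hg1201P0Jet_2_1 (⟨le_trans (by norm_num) hΔ.1, hΔ.2.trans (by norm_num)⟩) ha' hb hc).widen (by norm_num [SC]) (by norm_num [SC]) (by norm_num [SC])
        (by norm_num [SC]) (by norm_num [SC]) (by norm_num [SC])
  · rcases mem_Icc_split ha (61 / 50 : ℝ) with ha' | ha'
    · exact (hg1201P0Jet_3_0 hΔ ha' hb hc).widen (by norm_num [SC]) (by norm_num [SC]) (by norm_num [SC])
        (by norm_num [SC]) (by norm_num [SC]) (by norm_num [SC])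
    · exact (hg1201P0Jet_3_1 hΔ ha' hb hc).widen (by norm_num [SC]) (by norm_num [SC]) (by norm_num [SC])
        (by norm_num [SC]) (by norm_num [SC]) (by norm_num [SC])

end Summit.Ventures.CertifiedManyBodySolver.Downfold.Emery
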